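import Literature.MathematicalPhysics.StatisticalMechanics.BarlowStacking

/-!
# Line `vanishing-excess-truss-rigidity` (crux `CoarseGrains`, stmt-AtomisticToContinuum-9331): definitions for the certified lattice-sum computation (window pin)

Stub `stub_pinNumerics` of the line skeleton is a certified computation about the lattice sums of
`hcp(1,c)`, indexed by `v = (k,i,j) ∈ ℤ³` with squared site norm `x_v(c) = Q v + k²c²`,
`Q(k,i,j) = i² + ij + j² + [k odd](i + j + 1/3)`.  This file only DEFINES the objects of that
computation (D-0016: definitions are reviewed, proofs live in the sibling files
`…PinTail` (tail bound), `…PinEval` (evaluator soundness), `…PinBounds` (two-sided bounds),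
`…PinNumerics` (certificate and the stub)):

* real side: `pinQ`, `pinX` (the form and the squared norm), `pinS n c = ∑_{v ≠ 0} x_v(c)⁻ⁿ`,
  `pinD n c = ∑_{v ≠ 0} k² x_v(c)⁻ⁿ⁻¹` (the stub's `S`, `D`), `pinTail ρ` (the tail constant);
* integer/rational side (computable, evaluated by `native_decide`): `pinQ3 = 3Q`, `pinRange`,
  `pinBox` (the 8282 indices `v ≠ 0` with `x_v(39/50) ≤ 11²`), `pinN v p` (`x_v(p/2000) =
  pinN v p / (1.2·10⁷)`), the scaled floors `pinTS`, `pinTD` and their box sums `pinES`, `pinED`,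
  the rational envelopes `pinTailQ`, `pinSLo/SHi/DLo/DHi`, and the interval checks
  `pinCheckA/B/C`.

All `[folklore]` / `[computation]`.
-/

namespace Summit.AtomisticToContinuum.Crystallization.Theorems.ExcessDecayLiouvilleCoarseGrains

/-- `3·Q(v)` as an integer: `3(i² + ij + j²) + [k odd](3i + 3j + 1)` for `v = (k,i,j)`. [folklore] -/
def pinQ3 (v : ℤ × ℤ × ℤ) : ℤ :=
  3 * (v.2.1 ^ 2 + v.2.1 * v.2.2 + v.2.2 ^ 2) + (if Even v.1 then 0 else 3 * v.2.1 + 3 * v.2.2 + 1)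

/-- The quadratic form `Q(v) = i² + ij + j² + [k odd](i + j + 1/3)` of the stub statement (real). [folklore] -/
noncomputable def pinQ (v : ℤ × ℤ × ℤ) : ℝ :=
  (v.2.1 : ℝ) ^ 2 + (v.2.1 : ℝ) * v.2.2 + (v.2.2 : ℝ) ^ 2 +
    (if Even v.1 then 0 else ((v.2.1 : ℝ) + v.2.2 + 1 / 3))

/-- The squared site norm `x_v(c) = Q v + k² c²`. [folklore] -/
noncomputable def pinX (v : ℤ × ℤ × ℤ) (c : ℝ) : ℝ := pinQ v + (v.1 : ℝ) ^ 2 * c ^ 2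

/-- The tail constant `τ(ρ) = (27/19)·(3ρ/c₀ + 1)³/ρ⁶`, `c₀ = 39/50`. [folklore] -/
noncomputable def pinTail (ρ : ℝ) : ℝ := 27 / 19 * (3 * ρ / (39 / 50) + 1) ^ 3 / ρ ^ 6

/-- The symmetric integer range `{-m, …, m}` (computably, without `Finset.Icc`). [folklore] -/
def pinRange (m : ℕ) : Finset ℤ := (Finset.range (2 * m + 1)).image fun n : ℕ => (n : ℤ) - m

/-- The near index set: `v ≠ 0` in the box `|k| ≤ 15, |i| ≤ 19, |j| ≤ 14` passing the integer
test `x_v(39/50) ≤ 121`, i.e. `2500·(3Q v) + 4563·k² ≤ 907500`. [folklore] -/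
@[irreducible] def pinBox : Finset (ℤ × ℤ × ℤ) :=
  ((pinRange 15) ×ˢ ((pinRange 19) ×ˢ (pinRange 14))).filter
    fun v => v ≠ 0 ∧ 2500 * pinQ3 v + 4563 * v.1 ^ 2 ≤ 907500

/-- Numerator `N_v(p) = 4·10⁶·(3Q v) + 3k²p²`: `x_v(p/2000) = N_v(p)/(1.2·10⁷)`. [folklore] -/
def pinN (v : ℤ × ℤ × ℤ) (p : ℕ) : ℤ := 4000000 * pinQ3 v + 3 * v.1 ^ 2 * (p : ℤ) ^ 2

/-- Scaled floor of `x_v⁻ⁿ`: `⌊2⁶⁰ (1.2·10⁷)ⁿ / N_vⁿ⌋`. [folklore] -/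
def pinTS (n : ℕ) (v : ℤ × ℤ × ℤ) (p : ℕ) : ℕ := (2 ^ 60 * 12000000 ^ n) / (pinN v p).toNat ^ n

/-- Scaled floor of `k² x_v⁻ⁿ⁻¹`: `⌊2⁶⁰ k² (1.2·10⁷)ⁿ⁺¹ / N_vⁿ⁺¹⌋`. [folklore] -/
def pinTD (n : ℕ) (v : ℤ × ℤ × ℤ) (p : ℕ) : ℕ :=
  (2 ^ 60 * (v.1 ^ 2).toNat * 12000000 ^ (n + 1)) / (pinN v p).toNat ^ (n + 1)

/-- Box sum of the scaled floors of `x_v⁻ⁿ`. [folklore] -/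
def pinES (n p : ℕ) : ℕ := ∑ v ∈ pinBox, pinTS n v p

/-- Box sum of the scaled floors of `k² x_v⁻ⁿ⁻¹`. [folklore] -/
def pinED (n p : ℕ) : ℕ := ∑ v ∈ pinBox, pinTD n v p

/-- The series `S n c = ∑_{v ≠ 0} x_v(c)⁻ⁿ` of the stub (`S 3 = σ₆`, `S 6 = σ₁₂` of `hcp(1,c)`). [folklore] -/
noncomputable def pinS (n : ℕ) (c : ℝ) : ℝ := ∑' v : ℤ × ℤ × ℤ, if v = 0 then (0 : ℝ) else ((pinX v c)⁻¹) ^ n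

/-- The series `D n c = ∑_{v ≠ 0} k² x_v(c)⁻ⁿ⁻¹` of the stub (`d/dc S n c = −2nc·D n c`). [folklore] -/
noncomputable def pinD (n : ℕ) (c : ℝ) : ℝ :=
  ∑' v : ℤ × ℤ × ℤ, if v = 0 then (0 : ℝ) else (v.1 : ℝ) ^ 2 * ((pinX v c)⁻¹) ^ (n + 1)

/-- The tail constant `τ(11)` as a rational number. [folklore] -/
def pinTailQ : ℚ := 27 / 19 * (563 / 13) ^ 3 / 1771561

/-- Certified lower envelope of `S n` at `c = p/2000` (valid for `c ≤ p/2000`). [folklore] -/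
def pinSLo (n p : ℕ) : ℚ := (pinES n p : ℚ) / 2 ^ 60

/-- Certified upper envelope of `S n` at `c = p/2000` (valid for `c ≥ p/2000`). [folklore] -/
def pinSHi (n p : ℕ) : ℚ := ((pinES n p : ℚ) + pinBox.card) / 2 ^ 60 + (1 / 121) ^ (n - 3) * pinTailQ

/-- Certified lower envelope of `D n` at `c = p/2000` (valid for `c ≤ p/2000`). [folklore] -/
def pinDLo (n p : ℕ) : ℚ := (pinED n p : ℚ) / 2 ^ 60

/-- Certified upper envelope of `D n` at `c = p/2000` (valid for `c ≥ p/2000`). [folklore] -/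
def pinDHi (n p : ℕ) : ℚ :=
  ((pinED n p : ℚ) + pinBox.card) / 2 ^ 60 + (50 / 39) ^ 2 * (1 / 121) ^ (n - 3) * pinTailQ

/-- Check A on `[pl/2000, ph/2000]`: certified `S₆D₃ < S₃D₆`. [computation] -/
def pinCheckA (pl ph : ℕ) : Bool :=
  decide (pinSHi 6 pl * pinDHi 3 pl < pinSLo 3 ph * pinDLo 6 ph)

/-- Check B on `[pl/2000, ph/2000]`: certified `S₃D₆ < S₆D₃`. [computation] -/
def pinCheckB (pl ph : ℕ) : Bool :=
  decide (pinSHi 3 pl * pinDHi 6 pl < pinSLo 6 ph * pinDLo 3 ph)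

/-- Check C on `[pl/2000, ph/2000]`: certified ratio bounds. [computation] -/
def pinCheckC (pl ph : ℕ) : Bool :=
  decide (0 < pinSLo 3 ph ∧
    (189 / 200 : ℚ) ^ 6 * pinSHi 3 pl ≤ pinSLo 6 ph ∧
    pinSHi 6 pl ≤ (199 / 200 : ℚ) ^ 6 * pinSLo 3 ph ∧
    (189 / 200 : ℚ) ^ 6 * pinSHi 3 pl ≤ 27 / 8 * ((pl : ℚ) / 2000) ^ 6 * pinSLo 6 ph ∧
    27 / 8 * ((ph : ℚ) / 2000) ^ 6 * pinSHi 6 pl ≤ (199 / 200 : ℚ) ^ 6 * pinSLo 3 ph)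

/-- Anchor (registered sub-goal of stmt-9331): the real form is the integer form over `3`. [folklore] -/
theorem pinQ_eq_pinQ3_div : ∀ (ν : ℤ × ℤ × ℤ), pinQ ν = (pinQ3 ν : ℝ) / 3 := by
  intro ν
  unfold pinQ pinQ3
  split_ifs <;> push_cast <;> ring

end Summit.AtomisticToContinuum.Crystallization.Theorems.ExcessDecayLiouvilleCoarseGrains
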